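import Mathlib
import Literature.NumberTheory.LFunctions.WeilGroundState

/-!
# Sketch — crux-ideate stmt-RiemannHypothesis-1037 (GronwallLeakage), ideator 2, round 1

First lemmas of the idea card `dual-certificate-collapse` (Krein–Bochner dual certificates of
window positivity; Weil–Gauss quadrature; collapse at a conjugate point). Statements only
(`def … : Prop`); nothing here is asserted to hold.
-/

namespace Summit.RiemannHypothesis.RiemannHypothesis.Cruxes.GronwallLeakage.DualCertificate

open MeasureTheory Set Filter Complex Asymptotics
open scoped Topology Real

noncomputable section

open Literature.NumberTheory.LFunctions

/-- A **Krein–Bochner dual certificate** for Weil positivity at window `a`: a positive Borel measure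
`μ` on `ℝ` of polynomial growth whose pairing with the Mellin–Fourier transform on the critical line
reproduces the Weil functional `W = weilFunctional` on EVERY test kernel supported in the doubled
window `[-2a, 2a]` (i.e. `μ̂ = D_W` on the doubled window; Krein's spectral measure `σ` of the
truncated screw function of `ζ`, Suzuki 2023 Thm 1.2 + Arov–Dym Thm 8.1). -/
def IsWeilDualCertificate (a : ℝ) (μ : Measure ℝ) : Prop :=
  (∃ N : ℕ, Integrable (fun γ : ℝ => ((1 + γ ^ 2) ^ N)⁻¹) μ) ∧
  ∀ k : ℝ → ℂ, IsWeilTest k → tsupport k ⊆ Icc (-(2 * a)) (2 * a) →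
    Integrable (fun γ : ℝ => weilMellin k (1 / 2 + γ * I)) μ ∧
    weilFunctional k = ∫ γ, weilMellin k (1 / 2 + γ * I) ∂μ

/-- A **shifted certificate at level `c`**: reproduces `W(k) - c·k(0)` on the doubled window
(`k(0) = ‖g‖₂²` when `k = g ⋆ g̃`). Level `c = ε(a)` is the degenerate (optimal) shift. -/
def IsWeilShiftedCertificate (a c : ℝ) (μ : Measure ℝ) : Prop :=
  (∃ N : ℕ, Integrable (fun γ : ℝ => ((1 + γ ^ 2) ^ N)⁻¹) μ) ∧
  ∀ k : ℝ → ℂ, IsWeilTest k → tsupport k ⊆ Icc (-(2 * a)) (2 * a) →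
    Integrable (fun γ : ℝ => weilMellin k (1 / 2 + γ * I)) μ ∧
    weilFunctional k - (c : ℂ) * k 0 = ∫ γ, weilMellin k (1 / 2 + γ * I) ∂μ

/-- **L1 (easy direction, provable now).** A dual certificate at window `a` gives Weil positivity
on `[-a, a]`: `Re W(g ⋆ g̃) = ∫ |ĝ(1/2+iγ)|² dμ ≥ 0` (uses `weilMellin_weilConv`,
`weilMellin_weilReflect`). -/
def CertificateGivesPositivity : Prop :=
  ∀ a : ℝ, 0 < a → ∀ μ : Measure ℝ, IsWeilDualCertificate a μ → WeilPositivityOn a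

/-- **L1' (shifted version, provable now).** A shifted certificate at level `c` bounds the bottom
from below: `c ≤ ε(a)`. -/
def ShiftedCertificateBoundsEnergy : Prop :=
  ∀ a c : ℝ, 0 < a → ∀ μ : Measure ℝ, IsWeilShiftedCertificate a c μ → c ≤ weilGroundEnergy a

/-- **L2 (Krein's extension/representation theorem for screw functions on an interval, Arov–Dym
2008 Thm 8.1, through Suzuki's dictionary `W ↔ g_ζ`).** Positivity at window `a` yields dual
certificates on every strictly smaller doubled window. Literature fact to vendor. -/
def KreinExtension : Prop :=
  ∀ a : ℝ, 0 < a → WeilPositivityOn a →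
    ∀ a' : ℝ, 0 < a' → a' < a → ∃ μ : Measure ℝ, IsWeilDualCertificate a' μ

/-- **L2' (optimal shifted certificates = "flat-part budget").** For every window the degenerate
shift `c = ε(a)` still admits certificates on smaller doubled windows: `ε(a)/2π` is the largest
Lebesgue component a Krein spectral measure of the truncated screw function can carry. -/
def ShiftedKreinExtension : Prop :=
  ∀ a : ℝ, 0 < a → ∀ a' : ℝ, 0 < a' → a' < a →
    ∃ μ : Measure ℝ, IsWeilShiftedCertificate a' (weilGroundEnergy a) μ

/-- **L3 (collapse onto the ground-state zeros; Fatou).** A shifted certificate at the degenerate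
level `ε(a)` on the FULL doubled window is carried by the real zeros of the transform of every
ground state at `a` (Weil–Gauss quadrature nodes). At a conjugate point (`ε(a*) = 0`) this is the
collapse of ALL unshifted certificates. -/
def CollapseOntoGroundStateZeros : Prop :=
  ∀ a : ℝ, 0 < a → ∀ μ : Measure ℝ, IsWeilShiftedCertificate a (weilGroundEnergy a) μ →
    ∀ u : ℝ → ℂ, IsWeilGroundState a u →
      μ {γ : ℝ | weilMellin u (1 / 2 + γ * I) ≠ 0} = 0

/-- **L4 (uniqueness of the Weil–Gauss quadrature; Beurling–de Branges–Poltoratski gap theorem).**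
Two degenerate-level certificates on the full doubled window coincide: their difference is a signed
measure on a Cartwright zero set of density `a/π` with a spectral gap of length `4a > 2π·(a/π)`. -/
def WeilGaussQuadratureUnique : Prop :=
  ∀ a : ℝ, 0 < a → ∀ μ ν : Measure ℝ,
    IsWeilShiftedCertificate a (weilGroundEnergy a) μ →
    IsWeilShiftedCertificate a (weilGroundEnergy a) ν → μ = ν

/-- **L5 (smoothed Riemann–von Mangoldt law for certificates; unconditional, from the three-term
formula and Stirling for `Re ψ`).** Every certificate has local mass `‖h‖² log T + O(1)` against
the translated bump `|ĥ(·-T)|²`, `h` any test function on the window. -/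
def CertificateMassLaw : Prop :=
  ∀ a : ℝ, 0 < a → ∀ μ : Measure ℝ, IsWeilDualCertificate a μ →
    ∀ h : ℝ → ℂ, IsWeilTest h → tsupport h ⊆ Icc (-a) a →
      (fun T : ℝ => (∫ γ, ‖weilMellin h (1 / 2 + ((γ - T : ℝ) : ℂ) * I)‖ ^ 2 ∂μ)
          - (∫ t, ‖h t‖ ^ 2) * Real.log T) =O[atTop] fun _ : ℝ => (1 : ℝ)

/-- **L6 (Christoffel bound on point masses; provable now from positivity of `μ`).** -/
def ChristoffelWeightBound : Prop :=
  ∀ a : ℝ, 0 < a → ∀ μ : Measure ℝ, IsWeilDualCertificate a μ →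
    ∀ γ₀ : ℝ, ∀ h : ℝ → ℂ, IsWeilTest h → tsupport h ⊆ Icc (-a) a →
      (μ {γ₀}).toReal * ‖weilMellin h (1 / 2 + γ₀ * I)‖ ^ 2 ≤ (weilQuadratic h).re


/-- **L7 (consequence of L3 + L5 + L6 + Cartwright; unconditional target).** The transform of every
Weil ground state at window `a` has real zeros of FULL Cartwright density `2a/π` (counting both signs):
the optimal quadrature must carry Riemann–von Mangoldt mass `log T` per unit length with point masses
`≤ (1+o(1)) log T/(2a)`. A weak, RH-free cousin of Connes–van Suijlekom real-rootedness. -/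
def GroundStateRealZerosFullDensity : Prop :=
  ∀ a : ℝ, 0 < a → ∀ u : ℝ → ℂ, IsWeilGroundState a u →
    Tendsto (fun r : ℝ =>
      (Nat.card {γ : ℝ // |γ| ≤ r ∧ weilMellin u (1 / 2 + γ * I) = 0} : ℝ) / r)
      atTop (𝓝 (2 * a / Real.pi))

/-- **Discrete model of the product law (OPUC / finite Toeplitz; provable in Mathlib terms).** For a
positive definite Hermitian matrix with nested leading blocks, the bottom eigenvalue of the full matrix
is bounded below by the previous bottom times a factor depending only on the normalised coupling of the
new row (strengthened Cauchy–Schwarz constant `ρ < 1`): `λ_min(T') ≥ (1 - ρ) · min (λ_min T) d'` where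
`d'` is the new diagonal Schur datum. Stated here for real symmetric matrices via `Matrix.PosDef`. -/
def SchurStepModel : Prop :=
  ∀ (n : ℕ) (T : Matrix (Fin n) (Fin n) ℝ) (v : Fin n → ℝ) (d ρ m : ℝ),
    T.PosDef → 0 ≤ ρ → ρ < 1 → 0 < d → 0 < m →
    (∀ x : Fin n → ℝ, m * (dotProduct x x) ≤ dotProduct x (T.mulVec x)) →
    (∀ x : Fin n → ℝ, ∀ t : ℝ,
        |2 * t * dotProduct v x| ≤ ρ * (dotProduct x (T.mulVec x) + d * t ^ 2)) →
    ∀ x : Fin n → ℝ, ∀ t : ℝ,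
      (1 - ρ) * min m d * (dotProduct x x + t ^ 2) ≤
        dotProduct x (T.mulVec x) + 2 * t * dotProduct v x + d * t ^ 2

/-- **Transfer target C⁺ (no collapse = propagation of certificates).** With `KreinExtension`,
`CertificateGivesPositivity`, the proved anchor `weilPositivityOn_of_le_log_two_half`, continuity of
`ε` (proved `WindowContinuity`) and `StrictUnderRH`, this gives `ε > 0` on `(0, ∞)`; with the
regularity half (crux `WindowLipschitz`) it gives `GronwallLeakage`. -/
def NoCollapse : Prop :=
  ∀ a : ℝ, 0 < a → (∃ μ : Measure ℝ, IsWeilDualCertificate a μ) →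
    ∃ a' : ℝ, a < a' ∧ ∃ μ : Measure ℝ, IsWeilDualCertificate a' μ

/-- The glue this line owes (statement): no-collapse plus local absolute continuity of `log ε`
(the regularity half, here in the shape of the sibling crux `WindowLipschitz`) imply the crux. -/
def DualLineGlue : Prop :=
  KreinExtension → CertificateGivesPositivity → NoCollapse →
    (∀ b₀ A : ℝ, 0 < b₀ → b₀ ≤ A → ∃ L : ℝ, ∀ b a : ℝ, b₀ ≤ b → b ≤ a → a ≤ A →
        weilGroundEnergy b - weilGroundEnergy a ≤ L * (a - b)) →
    ∃ C : ℝ → ℝ, ∀ b a : ℝ, 0 < b → b ≤ a →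
      IntervalIntegrable C volume b a ∧
        weilGroundEnergy b * Real.exp (-(∫ x in b..a, C x)) ≤ weilGroundEnergy a

end

end Summit.RiemannHypothesis.RiemannHypothesis.Cruxes.GronwallLeakage.DualCertificate
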